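import Summits.CriticalPhenomena.CardyFormulaZ2.Theorems.CardyMagicRigidityNestingRigidityTowerMomentUpperCells
import Summits.CriticalPhenomena.CardyFormulaZ2.Theorems.CardyMagicRigidityNestingRigidityTowerMomentUpperPatterns
import HarnessLib

/-!
# A-priori polynomial UPPER bound on the tower moments, III: sorting the tower into the cells,
# and the moment bound from the two pattern majorants
# (helper [B-up] of line `positive-cone-weight-doubling`, crux `NestingRigidity`)

Crux `Summit.CriticalPhenomena.CardyFormulaZ2.Theses.CardyMagicRigidity.NestingRigidity`
(stmt-CriticalPhenomena-4835), line `positive-cone-weight-doubling`, registered helper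
`towerMoment_upper_latticeEnsembles` ([B-up]).  Model-free glue between the cells
(`…TowerMomentUpperCells`) and the pattern bookkeeping (`…TowerMomentUpperPatterns`):

* `TowerMomentUpper.exists_families`: a finite family `S` (`#S ≤ M`) of loops surrounding
  `B̄(0, r)` inside `B(0, 1)` is sorted into pairwise disjoint sub-families `T i ⊆ S`, one per cell,
  every loop of `T i` MEETING `B̄(c i, a i)` and LEAVING `B(c i, K a i)` (it passes through the
  annulus `r/2 < ‖z‖ < 2`, covered by the inner balls of the cells, and surrounds `0 ∉ B(c i, K a i)`),
  with multiplicities `m i = #T i ∈ Fin (M+1)`, `∑ i, m i = #S` — exactly the input of the joint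
  disjoint-occurrence lemmas `BigLoopsExp.mem_foldr_*_families` of `…BigLoopsExpMomentBK(T)`;
* `TowerMomentUpper.integral_pow_le_two_pow`: if almost every sample admits two patterns
  `m₀, m₁` (one per loop type) with `N ≤ ∑ m₀ + ∑ m₁` whose pattern events `D₀ m₀ ∋ ω`, `D₁ m₁ ∋ ω`
  have probability `≤ ∏ i, p ^ (m i)`, and `w² p ≤ 1/2`, then `E[w ^ N] ≤ 2 ^ B` (`w ≥ 1`;
  `w^{n₀+n₁} ≤ ((w²)^{n₀} + (w²)^{n₁})/2` and the two pattern majorants).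
-/

noncomputable section

open MeasureTheory Set Filter Metric
open scoped Real Topology BigOperators

namespace Summit.CriticalPhenomena.CardyFormulaZ2.Cruxes.NestingRigidity.PositiveConeWeightDoubling

open Literature.Probability.RandomPlanarGeometry
open Summit.CriticalPhenomena.CardyFormulaZ2.Cruxes.NestingRigidity.RingCloudTomography

namespace TowerMomentUpper

/-! ## Sorting the tower into the cells -/

/-- **Sorting the tower into the cells.**  Let `S` be a finite family of at most `M` loops, each
surrounding `B̄(0, r)` (`0 ≤ r < 2`) with trace in `B(0, 1)`, and let the cells `(c i, a i)` cover the
annulus `r/2 < ‖z‖ < 2` in the sense of `exists_cells` (`dist z (c i) ≤ a i`, `K a i ≤ ‖c i‖`).  Then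
`S` splits into pairwise disjoint finite sub-families `T i`, every loop of `T i` meeting `B̄(c i, a i)`
and `ℂ ∖ B(c i, K a i)`, with multiplicities `m i = #T i ∈ Fin (M + 1)` summing to `#S`. -/
theorem exists_families {S : Set (UnbasedLoop ℂ)} (hS : S.Finite) {M : ℕ} (hSM : S.ncard ≤ M)
    {r : ℝ} (hr : 0 ≤ r) (hr2 : r < 2)
    (htower : ∀ u ∈ S, closedBall (0 : ℂ) r ⊆ {z | u.wind z ≠ 0} ∧ u.range ⊆ ball (0 : ℂ) 1)
    {B : ℕ} {K : ℝ} (c : Fin B → ℂ) (a : Fin B → ℝ)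
    (hcov : ∀ z : ℂ, r / 2 < ‖z‖ → ‖z‖ < 2 → ∃ i, dist z (c i) ≤ a i ∧ K * a i ≤ ‖c i‖) :
    ∃ (T : Fin B → Set (UnbasedLoop ℂ)) (m : Fin B → Fin (M + 1)), (∀ i, T i ⊆ S) ∧
      (∀ i, (T i).Finite) ∧ (Pairwise fun i i' ↦ Disjoint (T i) (T i')) ∧
      (∀ i, ∀ u ∈ T i, (u.range ∩ closedBall (c i) (a i)).Nonempty ∧
        (u.range ∩ (ball (c i) (K * a i))ᶜ).Nonempty) ∧
      (∀ i, (m i : ℕ) = (T i).ncard) ∧ ∑ i, (m i : ℕ) = S.ncard := by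
  classical
  -- a default cell (the cells cover `z = 1`)
  obtain ⟨i₁, -⟩ := hcov 1 (by rw [norm_one]; linarith) (by rw [norm_one]; norm_num)
  -- the cell of a loop: one whose inner ball meets the trace and whose outer ball misses `0`
  set good : UnbasedLoop ℂ → Fin B → Prop := fun u i ↦
    (u.range ∩ closedBall (c i) (a i)).Nonempty ∧ K * a i ≤ ‖c i‖ with hgood
  set cell : UnbasedLoop ℂ → Fin B := fun u ↦ if h : ∃ i, good u i then h.choose else i₁ with hcell
  have hcellS : ∀ u ∈ S, good u (cell u) := by
    intro u hu
    have hex : ∃ i, good u i := by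
      obtain ⟨z, hz, hzr, hz1⟩ := exists_mem_range_norm u (htower u hu).1 (htower u hu).2
      obtain ⟨i, hi, hKi⟩ := hcov z (by linarith) (by linarith)
      exact ⟨i, ⟨z, hz, mem_closedBall.2 hi⟩, hKi⟩
    simp only [hcell, dif_pos hex]
    exact hex.choose_spec
  obtain ⟨T, m, hTS, hTfin, hTdisj, hTcell, hm, hsum⟩ := exists_sorting hS hSM cell
  refine ⟨T, m, hTS, hTfin, hTdisj, fun i u hu ↦ ?_, hm, hsum⟩
  have hg := hcellS u (hTS i hu)
  rw [hTcell i u hu] at hg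
  exact ⟨hg.1, range_inter_compl_ball_nonempty u hr (htower u (hTS i hu)).1 hg.2⟩

/-! ## The moment bound from the two pattern majorants -/

/-- **`E[w ^ N] ≤ 2 ^ B` from two BK pattern bounds** (`w ≥ 1`).  On a probability space let
`D₀ m`, `D₁ m` (`m : Fin B → Fin (M + 1)`) be measurable events of probability `≤ ∏ i, p ^ (m i)`,
`w² p ≤ 1/2`, and suppose almost every `ω` admits patterns `m₀, m₁` with
`N ω ≤ ∑ i, m₀ i + ∑ i, m₁ i`, `ω ∈ D₀ m₀`, `ω ∈ D₁ m₁`.  Then `∫ w ^ N ≤ 2 ^ B`: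
`w ^ N ≤ w^{∑ m₀} w^{∑ m₁} ≤ ((w²)^{∑ m₀} + (w²)^{∑ m₁}) / 2` is dominated by the mean of the two
pattern majorants, each of integral `≤ 2 ^ B` (`integral_sum_indicator_le_two_pow`).  No
measurability of `N` is needed. -/
theorem integral_pow_le_two_pow {Ω : Type*} [MeasurableSpace Ω] (μ : Measure Ω)
    [IsProbabilityMeasure μ] {B M : ℕ} (D₀ D₁ : (Fin B → Fin (M + 1)) → Set Ω)
    (hD₀ : ∀ m, MeasurableSet (D₀ m)) (hD₁ : ∀ m, MeasurableSet (D₁ m)) {p w : ℝ} (hp : 0 ≤ p)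
    (hw : 1 ≤ w) (hwp : w ^ 2 * p ≤ 1 / 2) (hμ₀ : ∀ m, μ.real (D₀ m) ≤ ∏ i, p ^ (m i : ℕ))
    (hμ₁ : ∀ m, μ.real (D₁ m) ≤ ∏ i, p ^ (m i : ℕ)) (N : Ω → ℕ)
    (hN : ∀ᵐ ω ∂μ, ∃ m₀ m₁ : Fin B → Fin (M + 1),
      N ω ≤ ∑ i, (m₀ i : ℕ) + ∑ i, (m₁ i : ℕ) ∧ ω ∈ D₀ m₀ ∧ ω ∈ D₁ m₁) :
    ∫ ω, w ^ N ω ∂μ ≤ 2 ^ B := by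
  have hw0 : 0 ≤ w := by linarith
  have hv0 : 0 ≤ w ^ 2 := by positivity
  obtain ⟨hint₀, hI₀⟩ := integral_sum_indicator_le_two_pow μ D₀ hD₀ hp hv0 hwp hμ₀
  obtain ⟨hint₁, hI₁⟩ := integral_sum_indicator_le_two_pow μ D₁ hD₁ hp hv0 hwp hμ₁
  calc ∫ ω, w ^ N ω ∂μ
      ≤ ∫ ω, ((∑ m : Fin B → Fin (M + 1), (D₀ m).indicator (fun _ ↦ (w ^ 2) ^ (∑ i, (m i : ℕ))) ω) +
          ∑ m : Fin B → Fin (M + 1), (D₁ m).indicator (fun _ ↦ (w ^ 2) ^ (∑ i, (m i : ℕ))) ω) / 2 ∂μ := by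
        refine integral_mono_of_nonneg (Eventually.of_forall fun ω ↦ pow_nonneg hw0 _)
          ((hint₀.add hint₁).div_const 2) ?_
        filter_upwards [hN] with ω hω
        obtain ⟨m₀, m₁, hNle, h₀, h₁⟩ := hω
        calc w ^ N ω ≤ w ^ (∑ i, (m₀ i : ℕ) + ∑ i, (m₁ i : ℕ)) := pow_le_pow_right₀ hw hNle
          _ = w ^ (∑ i, (m₀ i : ℕ)) * w ^ (∑ i, (m₁ i : ℕ)) := pow_add _ _ _
          _ ≤ ((w ^ 2) ^ (∑ i, (m₀ i : ℕ)) + (w ^ 2) ^ (∑ i, (m₁ i : ℕ))) / 2 :=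
              pow_mul_pow_le_half_add w _ _
          _ ≤ _ := by
              gcongr
              · exact pow_le_sum_indicator D₀ hv0 h₀
              · exact pow_le_sum_indicator D₁ hv0 h₁
    _ = ((∫ ω, ∑ m : Fin B → Fin (M + 1), (D₀ m).indicator (fun _ ↦ (w ^ 2) ^ (∑ i, (m i : ℕ))) ω ∂μ) +
          ∫ ω, ∑ m : Fin B → Fin (M + 1), (D₁ m).indicator (fun _ ↦ (w ^ 2) ^ (∑ i, (m i : ℕ))) ω ∂μ) / 2 := by
        rw [integral_div, integral_add hint₀ hint₁]
    _ ≤ (2 ^ B + 2 ^ B) / 2 := by gcongr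
    _ = 2 ^ B := by ring

end TowerMomentUpper

/-! ## Anchor: the sorting in registered form -/

/-- **Anchor (helper toward [B-up] `towerMoment_upper_latticeEnsembles`): sorting the tower into the
cells** (`TowerMomentUpper.exists_families`). -/
theorem towerMomentUpper_families : ∀ (S : Set (UnbasedLoop ℂ)) (M : ℕ) (r : ℝ) (B : ℕ) (K : ℝ) (c : Fin B → ℂ) (a : Fin B → ℝ), S.Finite → S.ncard ≤ M → 0 ≤ r → r < 2 → (∀ u ∈ S, Metric.closedBall (0 : ℂ) r ⊆ {z | u.wind z ≠ 0} ∧ u.range ⊆ Metric.ball (0 : ℂ) 1) → (∀ z : ℂ, r / 2 < ‖z‖ → ‖z‖ < 2 → ∃ i, dist z (c i) ≤ a i ∧ K * a i ≤ ‖c i‖) → ∃ (T : Fin B → Set (UnbasedLoop ℂ)) (m : Fin B → Fin (M + 1)), (∀ i, T i ⊆ S) ∧ (∀ i, (T i).Finite) ∧ (Pairwise fun i i' ↦ Disjoint (T i) (T i')) ∧ (∀ i, ∀ u ∈ T i, (u.range ∩ Metric.closedBall (c i) (a i)).Nonempty ∧ (u.range ∩ (Metric.ball (c i) (K * a i))ᶜ).Nonempty)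 ∧ (∀ i, (m i : ℕ) = (T i).ncard) ∧ ∑ i, (m i : ℕ) = S.ncard := by
  intro S M r B K c a hS hSM hr hr2 htower hcov
  exact TowerMomentUpper.exists_families hS hSM hr hr2 htower c a hcov

end Summit.CriticalPhenomena.CardyFormulaZ2.Cruxes.NestingRigidity.PositiveConeWeightDoubling

end
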